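import Summits.Ventures.Crystal3D.Theorems.StickyWulffConstantStackingLiminfChimeraStackWulff
import HarnessLib

/-!
# Chimera Brunn–Minkowski, MINKOWSKI-CONTENT form: the chimera `r`-neighbourhood of a layered set
# exceeds it by at least `3r·|W_0|^{1/3}|A|^{2/3}` — line `LayerChain`, stub `chimera` (b), crux
# `StackingLiminf` (stmt-Ventures-19145)

Route `StickyWulffConstant` of the venture `Summits/Ventures/Crystal3D` (cell `crystal3d-full`).
From `Chimera.chimera_stackWulff` (`…ChimeraStackWulff.lean`, p495655): for EVERY height profile
`f : ℝ → [0,1]`, every measurable `A ⊆ ℝ³` of finite volume, every `r > 0` and every measurable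
`C ⊇ {a + r•w | a ∈ A, w ∈ W_{f(a₂)}}`:
`|A| + 3r·|W_0|^{1/3}·|A|^{2/3} ≤ |C|`  (`chimera_stackWulff_content`; `|W_0| = 64√2`),
i.e. `(|C| − |A|)/r ≥ 3|W_0|^{1/3}|A|^{2/3}` for every `r > 0`, not only in the limit `r → 0` — the two
binomial terms of `(|A|^{1/3} + r|W_0|^{1/3})³`.  This is LITERALLY the lower bound
`F(E, λ) ≥ 3|W_0|^{1/3}|E|^{2/3}` of the card `Lines/LayerChain.md` (b) with the surface energy `F`
replaced by the chimera Minkowski content, valid for every profile with no regularity, obtained without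
transport.  WHAT THIS IS NOT: the perimeter form (needs «perimeter ≥ d/dr of the chimera volume» for the
blow-up limit object) nor the Γ-liminf half (a) of stub `chimera`; nothing discrete; rung F-C1 not moved.
-/

noncomputable section

namespace Summit.Ventures.Crystal3D.Theorems.Chimera

open MeasureTheory Set
open Summit.Ventures.Crystal3D.LayerChain (stackWulff)
open scoped ENNReal Pointwise

/-- Two binomial terms in `ℝ≥0∞`: `x³ + 3x²y ≤ (x + y)³`. -/
theorem pow_three_add_le (x y : ℝ≥0∞) : x ^ 3 + 3 * x ^ 2 * y ≤ (x + y) ^ 3 := by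
  calc x ^ 3 + 3 * x ^ 2 * y ≤ x ^ 3 + 3 * x ^ 2 * y + (3 * x * y ^ 2 + y ^ 3) := le_self_add
    _ = (x + y) ^ 3 := by ring

/-- **Chimera Minkowski content.**  For every profile `f : ℝ → [0,1]`, measurable `A` with `|A| < ∞`,
`r > 0` and measurable `C ⊇ {a + r•w | a ∈ A, w ∈ W_{f(a₂)}}`:
`|A| + 3·(r|W_0|^{1/3})·|A|^{2/3} ≤ |C|`. -/
theorem chimera_stackWulff_content {f : ℝ → ℝ} (hf : ∀ t, 0 ≤ f t ∧ f t ≤ 1)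
    {A C : Set (Fin 3 → ℝ)} (hA : MeasurableSet A) (hC : MeasurableSet C) {r : ℝ} (hr : 0 < r)
    (hsub : ∀ a ∈ A, ∀ w ∈ stackWulff (f (a 2)), a + r • w ∈ C) (hAt : volume A ≠ ⊤) :
    volume A + 3 * (ENNReal.ofReal r * volume (stackWulff 0) ^ ((3 : ℕ)⁻¹ : ℝ)) *
        volume A ^ ((2 : ℝ) / 3) ≤ volume C := by
  rcases eq_or_ne (volume A) 0 with hA0 | hA0
  · rw [hA0, ENNReal.zero_rpow_of_pos (by norm_num : (0 : ℝ) < 2 / 3), mul_zero, zero_add]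
    exact zero_le
  have h := chimera_stackWulff hf hA hC hr hsub hA0 hAt
  set x : ℝ≥0∞ := volume A ^ ((3 : ℕ)⁻¹ : ℝ) with hx
  set y : ℝ≥0∞ := ENNReal.ofReal r * volume (stackWulff 0) ^ ((3 : ℕ)⁻¹ : ℝ) with hy
  have hx3 : x ^ 3 = volume A := by
    rw [hx, ← ENNReal.rpow_natCast, ← ENNReal.rpow_mul]
    norm_num
  have hx2 : x ^ 2 = volume A ^ ((2 : ℝ) / 3) := by
    rw [hx, ← ENNReal.rpow_natCast, ← ENNReal.rpow_mul]
    norm_num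
  have hC3 : (volume C ^ ((3 : ℕ)⁻¹ : ℝ)) ^ 3 = volume C := by
    rw [← ENNReal.rpow_natCast, ← ENNReal.rpow_mul]
    norm_num
  have h3 : (x + y) ^ 3 ≤ (volume C ^ ((3 : ℕ)⁻¹ : ℝ)) ^ 3 := by gcongr
  calc volume A + 3 * y * volume A ^ ((2 : ℝ) / 3)
      = x ^ 3 + 3 * x ^ 2 * y := by rw [hx3, hx2]; ring
    _ ≤ (x + y) ^ 3 := pow_three_add_le x y
    _ ≤ (volume C ^ ((3 : ℕ)⁻¹ : ℝ)) ^ 3 := h3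
    _ = volume C := hC3

end Summit.Ventures.Crystal3D.Theorems.Chimera

end
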